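import Summits.BirchSwinnertonDyer.BirchSwinnertonDyer.Theorems.ManinLocalTwoThreePinningKernel
import HarnessLib

/-!
# Bracket–Sturm certificates BEYOND WEIGHT 2: products of certified coefficient tables

Cell `bsd-f2-manin`, route `ManinLocalTwoThree`, cruxes C2 `ManinOddAtFour` (stmt-BirchSwinnertonDyer-22967) and C3
`ManinPrimeToThreeAtNine` (stmt-BirchSwinnertonDyer-22968); prover seat p2 gen 31; `--supports` (helper).

WHY.  The headline `BracketSturm.abs_maninConstant_eq_one_of_defectList_eq_zero` is WEIGHT-GENERIC (`A B : ModularForm (Gamma0 N) k`,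
Sturm bound `(4k + 4)·μ₀(N)/12 < M`).  A class whose optimal modular degree `deg φ` satisfies `2·deg φ > 2μ₀(N)/12` (e.g. `132b`,
`deg φ = 30`; `189d`, `deg φ = 36`) admits NO weight-2 presentation `x∘φ = A/B` (`B` must vanish to order two on `φ⁻¹(O)`, more zeros
than a weight-2 form has), but it admits one of weight `4` with `A`, `B` integer combinations of the PRODUCTS `C_i · C_j` of the
kernel-pinned `η`-basis (exact linear algebra, seat p2 gen 31: nullity `16` for `132b`, `6` for `189d`; the weight-`12·…` defect
`216[A,B]² − F²(864A³ − 18c₄AB² − c₆B³)B` vanishes IN EXACT ARITHMETIC to the full Sturm depth `482` for both).  This file supplies the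
one missing glue lemma: the coefficient table of a product `f · g` below `M` is `mulList M l₁ l₂` of the certified tables of `f` and `g`
(Mathlib `ModularForm.qExpansion_mul` + the tree's `mulList_spec`), in the exact shape the headline's hypotheses `ha` / `hb` consume,
together with its linear-combination form.
HONEST FRAMING: elementary bookkeeping (standard axioms); nothing here proves C2/C3 for any `N`, Manin's conjecture or BSD.
[cite: Sturm1987, Thm. 1] [cite: AgasheRibetStein2006, §§1–2]
-/

set_option autoImplicit false
-- lint-debt: the directory name repeats the summit name (sibling precedent `ManinLocalTwoThreeBracketSturmLists.lean`)
set_option linter.dupNamespace false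

noncomputable section

open UpperHalfPlane hiding I
open scoped MatrixGroups ModularForm
open CongruenceSubgroup PowerSeries
open Literature.NumberTheory.ModularForms
open Literature.NumberTheory.EllipticCurves Literature.NumberTheory.EllipticCurves.ModularForms

namespace Summit.BirchSwinnertonDyer.BirchSwinnertonDyer.Theorems.ManinLocalTwoThree.BracketSturm

variable {N : ℕ} {k₁ k₂ : ℤ}

/-- **Products of certified coefficient tables.** If the integer tables `l₁`, `l₂` agree below `M` with the `q`-expansions of
`f ∈ M_{k₁}(Γ₀(N))` and `g ∈ M_{k₂}(Γ₀(N))`, then `mulList M l₁ l₂` agrees below `M` with the `q`-expansion of the weight-`(k₁ + k₂)`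
form `f · g`. [folklore] -/
theorem qExpansion_coeff_mul_eq_mulList (f : ModularForm (Gamma0 N) k₁) (g : ModularForm (Gamma0 N) k₂) {M : ℕ}
    {l₁ l₂ : List ℤ} (h₁ : ∀ n < M, ((l₁.getD n 0 : ℤ) : ℂ) = (qExpansion 1 ⇑f).coeff n)
    (h₂ : ∀ n < M, ((l₂.getD n 0 : ℤ) : ℂ) = (qExpansion 1 ⇑g).coeff n) :
    ∀ n < M, (((mulList M l₁ l₂).getD n 0 : ℤ) : ℂ) = (qExpansion 1 ⇑(f.mul g)).coeff n := by
  intro n hn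
  rw [ModularForm.qExpansion_mul one_pos (one_mem_strictPeriods_coe_gamma0 N)]
  have h := mulList_spec (Int.castRingHom ℂ) (M := M) (l₁ := l₁) (l₂ := l₂) (ψ₁ := qExpansion 1 ⇑f)
    (ψ₂ := qExpansion 1 ⇑g) (fun m hm ↦ by simpa using h₁ m hm) (fun m hm ↦ by simpa using h₂ m hm) n hn
  simpa using h

/-- **Squares**: the table of `f · f` below `M` is `mulList M l l`. [folklore] -/
theorem qExpansion_coeff_sq_eq_mulList (f : ModularForm (Gamma0 N) k₁) {M : ℕ} {l : List ℤ}
    (h : ∀ n < M, ((l.getD n 0 : ℤ) : ℂ) = (qExpansion 1 ⇑f).coeff n) :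
    ∀ n < M, (((mulList M l l).getD n 0 : ℤ) : ℂ) = (qExpansion 1 ⇑(f.mul f)).coeff n :=
  qExpansion_coeff_mul_eq_mulList f f h h

/-- **Integer combinations of certified tables** (any weight): if `t j` agrees below `M` with the `q`-expansion of `G j` for every
`j : Fin K`, and the integer table `a` satisfies the row identity `a[n] = Σ_j x_j · (t j)[n]` below `M`, then `a` agrees below `M` with
the `q`-expansion of `Σ_j x_j • G j` — the shape of the hypotheses `ha` / `hb` of `abs_maninConstant_eq_one_of_defectList_eq_zero`,
here for an arbitrary weight `k` (e.g. `G j = C_{i_j} · C_{i'_j}` of weight `2 + 2`). [folklore] -/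
theorem qExpansion_coeff_sum_smul_eq_of_rows [NeZero N] {k : ℤ} {K M : ℕ} (G : Fin K → ModularForm (Gamma0 N) k)
    (t : Fin K → List ℤ) (ht : ∀ j, ∀ n < M, (((t j).getD n 0 : ℤ) : ℂ) = (qExpansion 1 ⇑(G j)).coeff n)
    (x a : List ℤ) (hrow : ∀ n < M, a.getD n 0 = ∑ j : Fin K, x.getD (j : ℕ) 0 * (t j).getD n 0) :
    ∀ n < M, ((a.getD n 0 : ℤ) : ℂ) = (qExpansion 1 ⇑(∑ j : Fin K, ((x.getD (j : ℕ) 0 : ℤ) : ℂ) • G j)).coeff n := by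
  intro n hn
  change _ = PinningKernel.modCoefₗ N k n (∑ j : Fin K, ((x.getD (j : ℕ) 0 : ℤ) : ℂ) • G j)
  rw [map_sum]
  simp only [map_smul, smul_eq_mul, PinningKernel.modCoefₗ_apply]
  rw [hrow n hn]
  push_cast
  exact Finset.sum_congr rfl (fun j _ ↦ by rw [ht j n hn])

end Summit.BirchSwinnertonDyer.BirchSwinnertonDyer.Theorems.ManinLocalTwoThree.BracketSturm

end
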